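import Summits.BirchSwinnertonDyer.Rank1Residual.Additive.X4RankZeroKatoBound
import HarnessLib

/-!
# X4♯(3) on its potentially-good, big-image rows WITHOUT the Tamagawa hypothesis: `ord_p #Ш ≤ ord_p #Ш_an + ord_p ∏ c_ℓ − v_p(c_p)` and `BSD(E,3)` on the `c₃ = 3` rows, from the SHARPENED Kato 2004 Thm. 14.5 (3) reading (cell `b2b-bsdres`, line V20♯; port prepared by the Kato literature seat lit-kato for the X4 owner additive-p4)

HONEST FRAMING (cell `b2b-bsdres`, run/shared/lean/b2b/bsd-rank1-residual/, verbatim in every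
file): the goal of the cell is to DELETE the COMBINATION-SHAPED residual classes of the
Birch–Swinnerton-Dyer formula for ALL analytic-rank `≤ 1` elliptic curves over `ℚ` — "full BSD
formula for every rank `≤ 1` curve in class `C`" assembled STRICTLY from published theorems — so
that the rank-`≤ 1` remainder becomes exactly the CONSTRUCTION-SHAPED classes, which are TYPED
(missing-input `Prop`s), NOT attempted. This is not "finishing BSD". The additive sub-cell
(seats additive-p1…p4) is a RESEARCH ROUTE on the construction-shaped classes X3/X4; no claim
beyond the stated classes; labels unchanged; nothing is booked by this file.

**What this file proves** (theorems only; no definition, no new named fact). The sibling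
`X4RankZeroKatoBound.lean` (additive-p4, line V20) turns the named fact
`Kato2004.rankZero_padicValNat_sha_le_of_additive_potGood_of_imageContainsSL2` (K. Kato, Astérisque
295 (2004), Thm. 14.5 (3) with Prop. 14.16 (2); local index Kim AJM 2026 Lemma 3.10) into the typed
UPPER half and `BSD(E,3)` on X4 ∧ `r_an = 0` ∧ `ord_3 j ≥ 0` ∧ surj(3) ∧ ram(3) ∧ **`3 ∤ ∏ c_ℓ`**.
This file does the same from the SHARPENED reading
`Kato2004.rankZero_padicValNat_sha_le_sub_localTamagawa_of_additive_potGood_of_imageContainsSL2`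
(same file, appended by the Kato literature seat: the binder `p ∤ Tam(E)` is DROPPED and the
conclusion is `ord_p #Ш(E)[p^∞] ≤ ord_p(L(E,1)/Ω_E) − v_p(c_p)`, by Kim AJM 2026 §3.2.3's general
display `exp*_{ω_E}(H¹(ℚ_p,T)) = c_p · p^{−t}ℤ_p` at an additive `p > 2` in place of its special case
Lemma 3.10; audit `HOME/b2b-bsdres-lit-kato/KATO2004-TYPING.md` §8.1 R1 / §9):
* `padicValNat_shaOrder_le_of_katoSharp_rankZero`: `#Ш_an = q` and
  `ord_p #Ш ≤ ord_p q + ord_p ∏ c_ℓ − v_p(c_p) − 2 ord_p #E(ℚ)_tors` at every odd additive potentially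
  good `p` with (12.5.2) — NO Tamagawa hypothesis;
* `X4RankZero.padicValNat_shaOrder_le_of_katoSharp` (census shape over `ClassX4`, tower
  surjectivity): `ord_p #Ш ≤ ord_p #Ш_an + ord_p ∏ c_ℓ − v_p(c_p)`;
* `X4RankZero.missingUpperBoundAt_of_katoSharp`: the typed UPPER half `MissingUpperBoundAt W p` on the
  rows where `p` divides `∏ c_ℓ` ONLY through `c_p` — per-pair certificate
  `ord_p ∏_ℓ c_ℓ = ord_p c_p` (`c_p = (W.baseChange ℚ_[p]).localTamagawaNumber ℤ_[p]`);
* `X4RankZero.bsdp_of_shaAn_unit_of_katoSharp`: `BSD(E,p)` on those rows when `#Ш_an` is a `p`-unit;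
* `X4RankZero.bsdp_three_of_katoSharp_of_surj_of_ram` — THE CENSUS SHAPE at `p = 3`: X4 ∧ `r_an = 0` ∧
  `ord_3 j ≥ 0` ∧ surj(3) ∧ ram(3) ∧ `ord_3 ∏ c_ℓ = ord_3 c_3` ∧ `3 ∤ #Ш_an` ∧ Manin datum `⇒ BSD(E,3)`;
* `x4SharpThree_holds_of_potGood_of_towerSurj_sharp` — the conjecture `X4SharpThree`'s conclusion
  `ord_3 #Ш ≤ ord_3 #Ш_an + ord_3 ∏ c_ℓ` on EVERY potentially good tower-surjective row (no `3 ∤ ∏ c_ℓ`).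
These are exactly the X4 ∧ `p = 3` ∧ `r_an = 0` rows with Kodaira type IV or IV* at `3` and `c₃ = 3`
that the sibling's `3 ∤ ∏ c_ℓ` excludes. CENSUS (UNCERTIFIED, single engine = hyp seat GEN 24
`tamk3lib.py` engine A-K, Tate's algorithm over `ℤ_3`, run by lit-kato; files
`HOME/b2b-bsdres-lit-kato/R1-tamagawa-split-engineAK.tsv` (window) and `R1-SWEEP-engineAK.tsv`
(sweep)): window `N < 2·10⁴ ‖ N < 10⁴` (hyp universe, curves): of the 167 ‖ 36 X4@3 r0 pot-good
surj ∧ ram rows with `3 ∣ ∏ c_ℓ`, `3 ∤ #Ш_an`, **39 ‖ 8 close** (`c₃ = 3`, `3 ∤ ∏_{ℓ≠3} c_ℓ`), 128 ‖ 28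
get the upper half only; sweep `N < 5·10⁵` (additive-p4's `V20-SWEEP-CENSUS`, S-b residue units):
24 234 candidate pairs, **7 029 close** (IV*: 4 282, IV: 2 747), 17 205 upper half only — CONFIRMED
by a second engine (rmap-2 GEN 4, PARI `elllocalred`/`ellglobalred`, kit job j111773: 0 disagreements
on the 167 window rows; sweep R1 set 84 816 = V20 77 787 + 7 029); booking is the lane's, per pair.
Per pair; the class label X4 is UNCHANGED (CONSTRUCTION-SHAPED); nothing is booked by this file.

References: Kato 2004 [Kato2004Asterisque] Thm. 14.5 (3) (p. 236), Prop. 14.16 (2) (p. 244), §14.8,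
Thm. 12.5 (1); Kim 2026 [Kim2022StructureSelmer] §3.2.3 display (PDF p. 16), Remark 3.8, Lemma 3.10;
Miller 2011 [Miller2011LMS] Def. 1.1; Mazur 1977 [Mazur1977] III.5 (torsion vs irreducibility).
-/

noncomputable section

open scoped Classical

namespace Summit.BirchSwinnertonDyer.Rank1Residual.Additive

open WeierstrassCurve Literature.NumberTheory.EllipticCurves
  Literature.NumberTheory.EllipticCurves.ModularForms
  Literature.NumberTheory.EllipticCurves.Rank1Residual
  Literature.NumberTheory.EllipticCurves.Rank1Residual.Typed

variable (W : WeierstrassCurve ℚ) [W.IsElliptic] [W.IsGloballyMinimal] (p : ℕ) [Fact p.Prime]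

/-- **Rank-`0` upper bound with the torsion term AND the local Tamagawa term, from the SHARPENED Kato
reading** (Kato 14.5 (3) + 14.16 (2), Kim §3.2.3 display): `#Ш_an = q` and
`ord_p #Ш ≤ ord_p q + ord_p ∏ c_ℓ − v_p(c_p) − 2 ord_p #E(ℚ)_tors`. No Tamagawa hypothesis.
[cite: Kato2004Asterisque, Thm. 14.5 (3) (p. 236), Prop. 14.16 (2) (p. 244)] [cite: Miller2011LMS, Def. 1.1] -/
theorem padicValNat_shaOrder_le_of_katoSharp_rankZero
    (hKato : Kato2004.rankZero_padicValNat_sha_le_sub_localTamagawa_of_additive_potGood_of_imageContainsSL2)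
    (hGZK : rank_eq_analyticRank_of_analyticRank_le_one) (hmod : hasEntireLFunction_rat)
    (hp : p ≠ 2) (hgood : ¬ W.HasGoodReductionAtPrime p) (hmult : ¬ W.HasMultiplicativeReductionAtPrime p)
    (hpot : 0 ≤ padicValRat p W.j) (hbig : Kato2004.ImageContainsSL2 W p) (hr : W.analyticRank = 0)
    {N : ℕ} [NeZero N] (D : ModularParametrizationData W N) (hc : ¬ (p : ℤ) ∣ D.maninConstant) :
    ∃ q : ℚ, shaAn W = (q : ℂ) ∧
      (padicValNat p W.shaOrder : ℤ) ≤
        padicValRat p q + padicValNat p W.tamagawaProduct - padicValNat p ((W.baseChange ℚ_[p]).localTamagawaNumber ℤ_[p])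
          - 2 * padicValNat p W.torsionOrder := by
  have hL : W.entireLFunction 1 ≠ 0 := (W.analyticRank_eq_zero_iff_holds (hmod W)).mp hr
  obtain ⟨hmw, hfin⟩ := hGZK W (by rw [hr]; exact zero_le_one)
  haveI : Finite W.sha := hfin
  have hmw0 : W.mordellWeilRank = 0 := by rw [hmw, hr]
  obtain ⟨q₀, hq₀, hle⟩ := hKato W p hp hgood hmult hpot hbig hL hfin D hc
  have hΩpos : 0 < W.realPeriodRat := W.realPeriodRat_pos_holds
  have hΩ : (W.realPeriodRat : ℂ) ≠ 0 := by exact_mod_cast hΩpos.ne'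
  have hc0 : 0 < W.tamagawaProduct := W.tamagawaProduct_pos_holds
  have ht0 : 0 < W.torsionOrder := W.torsionOrder_pos_holds
  have hq₀0 : q₀ ≠ 0 := by
    rintro rfl
    rw [Rat.cast_zero, div_eq_zero_iff] at hq₀
    exact hq₀.elim hL hΩ
  refine ⟨q₀ * (W.torsionOrder : ℚ) ^ 2 / (W.tamagawaProduct : ℚ), ?_, ?_⟩
  · have hLq : W.entireLFunction 1 = (q₀ : ℂ) * (W.realPeriodRat : ℂ) := by
      rw [← hq₀, div_mul_cancel₀ _ hΩ]
    rw [shaAn_def, leadingLCoeff_eq_of_analyticRank_eq_zero W hr,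
      W.regulator_eq_one_of_rank_zero hmw0, hLq]
    push_cast
    field_simp
  · have ht : (W.torsionOrder : ℚ) ≠ 0 := by exact_mod_cast ht0.ne'
    have hcq : (W.tamagawaProduct : ℚ) ≠ 0 := by exact_mod_cast hc0.ne'
    have hsha : padicValNat p (Nat.card (AddCommGroup.primaryComponent W.sha p)) =
        padicValNat p W.shaOrder := by
      unfold WeierstrassCurve.shaOrder
      exact padicValNat_card_addPrimaryComponent p
    have hv : padicValRat p (q₀ * (W.torsionOrder : ℚ) ^ 2 / (W.tamagawaProduct : ℚ)) =
        padicValRat p q₀ + 2 * (padicValNat p W.torsionOrder : ℤ) -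
          (padicValNat p W.tamagawaProduct : ℤ) := by
      rw [padicValRat.div (mul_ne_zero hq₀0 (pow_ne_zero 2 ht)) hcq,
        padicValRat.mul hq₀0 (pow_ne_zero 2 ht), pow_two, padicValRat.mul ht ht,
        padicValRat.of_nat, padicValRat.of_nat]
      ring
    rw [hv, ← hsha]
    linarith

/-- **X4 ∧ `r = 0` at an odd potentially good additive `p` with tower surjectivity, datum `D` with
`p ∤ c_D`: `ord_p #Ш ≤ ord_p #Ш_an + ord_p ∏ c_ℓ − v_p(c_p)`** (torsion term killed by irreducibility).
[cite: Kato2004Asterisque, Thm. 14.5 (3) (p. 236), (12.5.2) (p. 222)] [cite: Mazur1977, Ch. III §5, p. 157] -/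
theorem X4RankZero.padicValNat_shaOrder_le_of_katoSharp
    (hKato : Kato2004.rankZero_padicValNat_sha_le_sub_localTamagawa_of_additive_potGood_of_imageContainsSL2)
    (hGZK : rank_eq_analyticRank_of_analyticRank_le_one) (hmod : hasEntireLFunction_rat)
    (hr : W.analyticRank = 0) (hX : ClassX4 W p) (hpot : 0 ≤ padicValRat p W.j)
    (hsurj : ∀ n : ℕ, W.HasSurjectiveModNGaloisRep (p ^ n : ℕ))
    {N : ℕ} [NeZero N] (D : ModularParametrizationData W N) (hc : ¬ (p : ℤ) ∣ D.maninConstant) :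
    ∃ q : ℚ, shaAn W = (q : ℂ) ∧
      (padicValNat p W.shaOrder : ℤ) ≤
        padicValRat p q + padicValNat p W.tamagawaProduct - padicValNat p ((W.baseChange ℚ_[p]).localTamagawaNumber ℤ_[p]) := by
  obtain ⟨hp2, ⟨hgood, hmult⟩, hirr⟩ := hX
  obtain ⟨q, hq, hle⟩ :=
    padicValNat_shaOrder_le_of_katoSharp_rankZero W p hKato hGZK hmod hp2 hgood hmult hpot
      (Kato2004.imageContainsSL2_of_forall_hasSurjectiveModNGaloisRep W p hsurj) hr D hc
  refine ⟨q, hq, ?_⟩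
  rw [padicValNat_torsionOrder_eq_zero_of_irreducible W p hirr] at hle
  simpa using hle

/-- **The typed UPPER half on the rows where `p` divides `∏ c_ℓ` ONLY through `c_p`**: X4 ∧ `r = 0`,
odd potentially good additive `p`, tower surjectivity, `p ∤ c_D`, and the per-pair certificate
`ord_p ∏_ℓ c_ℓ = ord_p c_p` (i.e. `p ∤ c_ℓ` for `ℓ ≠ p`) ⟹ `MissingUpperBoundAt W p`.
[cite: Kato2004Asterisque, Thm. 14.5 (3) (p. 236)] [cite: Miller2011LMS, Def. 1.1] -/
theorem X4RankZero.missingUpperBoundAt_of_katoSharp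
    (hKato : Kato2004.rankZero_padicValNat_sha_le_sub_localTamagawa_of_additive_potGood_of_imageContainsSL2)
    (hGZK : rank_eq_analyticRank_of_analyticRank_le_one) (hmod : hasEntireLFunction_rat)
    (hr : W.analyticRank = 0) (hX : ClassX4 W p) (hpot : 0 ≤ padicValRat p W.j)
    (hsurj : ∀ n : ℕ, W.HasSurjectiveModNGaloisRep (p ^ n : ℕ))
    (htam : padicValNat p W.tamagawaProduct = padicValNat p ((W.baseChange ℚ_[p]).localTamagawaNumber ℤ_[p]))
    {N : ℕ} [NeZero N] (D : ModularParametrizationData W N) (hc : ¬ (p : ℤ) ∣ D.maninConstant) :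
    MissingUpperBoundAt W p := by
  obtain ⟨q, hq, hle⟩ :=
    X4RankZero.padicValNat_shaOrder_le_of_katoSharp W p hKato hGZK hmod hr hX hpot hsurj D hc
  refine ⟨q, hq, ?_⟩
  rw [htam] at hle
  linarith

/-- **`BSD(E,p)` on these rows when `#Ш_an` is a `p`-unit** (in particular on the X4 ∧ `p = 3` rows
with `c₃ = 3`, `3 ∤ ∏_{ℓ≠3} c_ℓ`, `3 ∤ #Ш_an`, excluded from V20 by its `3 ∤ ∏ c_ℓ`).
[cite: Kato2004Asterisque, Thm. 14.5 (3) (p. 236)] [cite: Miller2011LMS, §1 and Def. 1.1] -/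
theorem X4RankZero.bsdp_of_shaAn_unit_of_katoSharp
    (hKato : Kato2004.rankZero_padicValNat_sha_le_sub_localTamagawa_of_additive_potGood_of_imageContainsSL2)
    (hGZK : rank_eq_analyticRank_of_analyticRank_le_one) (hmod : hasEntireLFunction_rat)
    (hr : W.analyticRank = 0) (hX : ClassX4 W p) (hpot : 0 ≤ padicValRat p W.j)
    (hsurj : ∀ n : ℕ, W.HasSurjectiveModNGaloisRep (p ^ n : ℕ))
    (htam : padicValNat p W.tamagawaProduct = padicValNat p ((W.baseChange ℚ_[p]).localTamagawaNumber ℤ_[p]))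
    {N : ℕ} [NeZero N] (D : ModularParametrizationData W N) (hc : ¬ (p : ℤ) ∣ D.maninConstant)
    {q : ℚ} (hq : shaAn W = (q : ℂ)) (hv : padicValRat p q = 0) : BSDp W p := by
  obtain ⟨q', hq', hle⟩ :=
    X4RankZero.missingUpperBoundAt_of_katoSharp W p hKato hGZK hmod hr hX hpot hsurj htam D hc
  have hqq : q' = q := by exact_mod_cast hq'.symm.trans hq
  subst hqq
  rw [hv] at hle
  have h0 : padicValNat p W.shaOrder = 0 := by exact_mod_cast le_antisymm hle (by positivity)
  exact bsdp_of_missingPPartAt W p hGZK (by rw [hr]; exact zero_le_one)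
    ⟨q', hq', by rw [hv, h0, Nat.cast_zero]⟩

/-- **Census shape at `p = 3`** (surj(3) ∧ ram(3) feed the tower surjectivity): X4 ∧ `r_an = 0` ∧
`ord_3 j ≥ 0` ∧ surj(3) ∧ ram(3) ∧ `ord_3 ∏ c_ℓ = ord_3 c_3` ∧ `3 ∤ #Ш_an` ∧ `3 ∤ c_D` ⟹ `BSD(E,3)`.
[cite: Kato2004Asterisque, Thm. 14.5 (3) (p. 236), (12.5.2) (p. 222)] [cite: Miller2011LMS, §1 and Def. 1.1] -/
theorem X4RankZero.bsdp_three_of_katoSharp_of_surj_of_ram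
    (hKato : Kato2004.rankZero_padicValNat_sha_le_sub_localTamagawa_of_additive_potGood_of_imageContainsSL2)
    (hGZK : rank_eq_analyticRank_of_analyticRank_le_one) (hmod : hasEntireLFunction_rat)
    (hr : W.analyticRank = 0) (hX : ClassX4 W 3) (hpot : 0 ≤ padicValRat 3 W.j) (hsurj : Surj W 3)
    (hram : Ram W 3)
    (htam : padicValNat 3 W.tamagawaProduct =
      padicValNat 3 ((WeierstrassCurve.baseChange W ℚ_[3]).localTamagawaNumber ℤ_[3]))
    {N : ℕ} [NeZero N] (D : ModularParametrizationData W N) (hc : ¬ (3 : ℤ) ∣ D.maninConstant)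
    {q : ℚ} (hq : shaAn W = (q : ℂ)) (hv : padicValRat 3 q = 0) : BSDp W 3 :=
  X4RankZero.bsdp_of_shaAn_unit_of_katoSharp W 3 hKato hGZK hmod hr hX hpot
    (hasSurjectiveModNGaloisRep_pow_of_hasMultiplicativeReductionAtPrime W 3 hsurj hram) htam D
    (by exact_mod_cast hc) hq hv

/-- **X4♯(3)'s conclusion on EVERY potentially good, tower-surjective row — NO Tamagawa hypothesis**
(sharp twin of `x4SharpThree_holds_of_potGood_of_towerSurj`, which needs `3 ∤ ∏ c_ℓ`): X4 ∧
`r_an = 0` ∧ `ord_3 j ≥ 0` ∧ `ρ̄_{E,3^n}` onto for all `n` ∧ Manin datum ⟹ `#Ш_an = q` and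
`ord_3 #Ш ≤ ord_3 q + ord_3 ∏ c_ℓ` (drop the subtracted `v_3(c_3) ≥ 0` from
`X4RankZero.padicValNat_shaOrder_le_of_katoSharp`). These are the rows of the conjecture
`Additive.X4SharpThree` left open only by `3 ∣ ∏ c_ℓ` on the potentially good tower-surjective locus.
[cite: Kato2004Asterisque, Thm. 14.5 (3) (p. 236), Prop. 14.16 (2) (p. 244)] [cite: Miller2011LMS, Def. 1.1] -/
theorem x4SharpThree_holds_of_potGood_of_towerSurj_sharp
    (hKato : Kato2004.rankZero_padicValNat_sha_le_sub_localTamagawa_of_additive_potGood_of_imageContainsSL2)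
    (hGZK : rank_eq_analyticRank_of_analyticRank_le_one) (hmod : hasEntireLFunction_rat)
    (hr : W.analyticRank = 0) (hX : ClassX4 W 3) (hpot : 0 ≤ padicValRat 3 W.j)
    (hsurj : ∀ n : ℕ, W.HasSurjectiveModNGaloisRep (3 ^ n : ℕ))
    {N : ℕ} [NeZero N] (D : ModularParametrizationData W N) (hc : ¬ (3 : ℤ) ∣ D.maninConstant) :
    ∃ q : ℚ, shaAn W = (q : ℂ) ∧
      (padicValNat 3 W.shaOrder : ℤ) ≤ padicValRat 3 q + padicValNat 3 W.tamagawaProduct := by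
  obtain ⟨q, hq, hle⟩ :=
    X4RankZero.padicValNat_shaOrder_le_of_katoSharp W 3 hKato hGZK hmod hr hX hpot hsurj D
      (by exact_mod_cast hc)
  refine ⟨q, hq, hle.trans ?_⟩
  have h0 : (0 : ℤ) ≤ padicValNat 3 ((WeierstrassCurve.baseChange W ℚ_[3]).localTamagawaNumber ℤ_[3]) := by
    positivity
  linarith

end Summit.BirchSwinnertonDyer.Rank1Residual.Additive

end
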